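import Summits.BirchSwinnertonDyer.Rank1Residual.Iwasawa.LocalTowerKernelCardLeTorsion
import Summits.BirchSwinnertonDyer.Rank1Residual.X11b.LocalTorsionAwayFromP
import Literature.NumberTheory.EllipticCurves.TamagawaNeZeroProofs
import Literature.NumberTheory.EllipticCurves.TamagawaRingEquivProofs
import HarnessLib

/-!
# Tamagawa-tolerant control, III (`K = ℚ`): `#E(ℚ_ℓ)[p^∞] ∣ c_ℓ · #Ẽ_ns(𝔽_ℓ)`, hence
# `#𝒦_{ℓ,0}[p^∞] ≤ p ^ ord_p (c_ℓ · N_ℓ)` at every `ℓ ≠ p` — and `≤ p ^ ord_p c_ℓ` when `p ∤ N_ℓ`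
# (team n1011, row T-CTL-TAM, seat p06 GEN 10, FILE 3)

HONEST FRAMING (cell `b2b-bsdres-*`, team n1011, verbatim): prove what is provable now; shrink each
hard class to its core with data; no claim beyond stated classes. Research route; TOOL theorems
only — no definition, no named fact, nothing booked, no residual-map mark moved, no class closed.

## What

FILE 2 (`Iwasawa/LocalTowerKernelCardLeTorsion`) bounds the `p`-power torsion of the level-`0` local
tower kernel at `v ∤ p` by `#E(K_v)[p^∞]` (any number field, any `ℤ_p`-extension, any reduction).
Over `ℚ`, for a GLOBALLY MINIMAL `W` (the index formula and `N_ℓ = reductionPointCount W ℓ` are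
minimal-model statements) and primes `ℓ ≠ p`, the local filtration gives the arithmetic of that
bound: `E₁(ℚ_ℓ)` has no `p`-torsion (x11b `LocalTorsion.eq_zero_of_isInReductionKernel_of_prime_nsmul`,
Silverman VII.3.1 / IV.3.2) and `[E(ℚ_ℓ) : E₁(ℚ_ℓ)] = c_ℓ · N_ℓ`, `N_ℓ = #Ẽ_ns(𝔽_ℓ)` (x11b
`LocalTorsion.index_formalFiltration_one_eq`, Silverman VII.2.1 / VII.6.1), so
`E(ℚ_ℓ)[p^∞] ↪ E(ℚ_ℓ)/E₁(ℚ_ℓ)` and `#E(ℚ_ℓ)[p^∞] ∣ c_ℓ · N_ℓ`: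

* `natCard_primaryComponent_padic_dvd` — `#E(ℚ_[ℓ])[p^∞] ∣ c_ℓ · N_ℓ` (`c_ℓ` read at the place of
  `ℚ` above `ℓ`);
* `natCard_primaryComponent_adicCompletion_eq` — transport `E(ℚ_v)[p^∞] ≃ E(ℚ_[ℓ])[p^∞]` along
  Mathlib's `adicCompletion.padicEquiv v` (cardinalities; `v` the place with `primesEquiv v = ℓ`);
* **`natCard_localTowerKerPrimary_zero_le_pow_padicValNat_rat`** — for every `ℤ_p`-extension `κ`
  of `ℚ` and every prime `ℓ ≠ p`: `#𝒦_{v,0}[p^∞] ≤ p ^ ord_p (c_ℓ · N_ℓ)`;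
* **`natCard_localTowerKerPrimary_zero_le_pow_padicValNat_of_not_dvd`** — if `p ∤ N_ℓ`
  ("non-anomalous at the bad prime `ℓ`": `p ∤ ℓ − 1` at split, `p ∤ ℓ + 1` at non-split, automatic at
  additive `ℓ`), then `#𝒦_{v,0}[p^∞] ≤ p ^ ord_p c_ℓ` — the exponent the Tamagawa-tolerant consumer
  (FILE 4) sums against `ord_p Tam(E)`.

Compared with row T-T3CTL F2c (`Iwasawa/LocalTowerKernelNumericTest`: `p ∤ c_ℓ · N_ℓ ⟹ 𝒦 = ⊥`) the
Tamagawa factor is no longer required to be prime to `p`. NOT claimed: Greenberg's sharp `c_ℓ^{(p)}`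
when `p ∣ N_ℓ` (LNM 1716 p. 88; X11b has it in the `GreenbergSelmer` currency). Axioms standard.

References: [GreenbergLNM1716] §3 Lemma 3.3 (pp. 86–88), Prop. 3.8 Remark (p. 95);
[SilvermanAEC2009] VII.2.1, VII.3.1, VII.6.1, Cor. VII.6.2.
-/

noncomputable section

open scoped Classical

namespace Summit.BirchSwinnertonDyer.Rank1Residual.Iwasawa

open Literature.NumberTheory.EllipticCurves NumberField IsDedekindDomain WeierstrassCurve
  Rat.HeightOneSpectrum Summit.BirchSwinnertonDyer.Rank1Residual.X11b

variable (W : WeierstrassCurve ℚ) [W.IsElliptic] [W.IsGloballyMinimal]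

/-! ## §1. `#E(ℚ_ℓ)[p^∞] ∣ c_ℓ · N_ℓ` -/

/-- **`E(ℚ_ℓ)[p^∞] ↪ E(ℚ_ℓ)/E₁(ℚ_ℓ)`, so `#E(ℚ_ℓ)[p^∞] ∣ [E(ℚ_ℓ) : E₁(ℚ_ℓ)] = c_ℓ · N_ℓ`** (`ℓ ≠ p`;
`W` globally minimal; `N_ℓ = reductionPointCount W ℓ = #Ẽ_ns(𝔽_ℓ)`, `c_ℓ` the local Tamagawa number at
the place of `ℚ` above `ℓ`): a `p`-power torsion point in the kernel of reduction is `O`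
(`LocalTorsion.eq_zero_of_isInReductionKernel_of_prime_nsmul`, iterated), and Lagrange in
`E(ℚ_ℓ)/E₁(ℚ_ℓ)`. [cite: SilvermanAEC2009, VII.2 Prop. 2.1, VII.3 Prop. 3.1 and VII.6.1] -/
theorem natCard_primaryComponent_padic_dvd (ℓ p : ℕ) [Fact ℓ.Prime] [hp : Fact p.Prime]
    (hℓp : ℓ ≠ p) :
    Nat.card (AddCommGroup.primaryComponent (W.baseChange ℚ_[ℓ]).toAffine.Point p) ∣
      (W.baseChange ((ratPlace ℓ).adicCompletion ℚ)).localTamagawaNumber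
          ((ratPlace ℓ).adicCompletionIntegers ℚ) * reductionPointCount W ℓ := by
  rw [← LocalTorsion.index_formalFiltration_one_eq W ℓ]
  set T := AddCommGroup.primaryComponent (W.baseChange ℚ_[ℓ]).toAffine.Point p with hT
  set E1 := (W.baseChange ℚ_[ℓ]).formalFiltration 1 with hE1
  -- `E₁(ℚ_ℓ)[p^∞] = 0`
  have key : ∀ (j : ℕ) (Q : (W.baseChange ℚ_[ℓ]).toAffine.Point), Q ∈ E1 → p ^ j • Q = 0 → Q = 0 := by
    intro j
    induction j with
    | zero => intro Q _ hQ; simpa using hQ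
    | succ j ih =>
      intro Q hQ hpQ
      have h1 : p ^ j • Q ∈ E1 := E1.nsmul_mem hQ _
      have h2 : p • (p ^ j • Q) = 0 := by rw [← mul_smul, ← pow_succ', hpQ]
      have h3 : p ^ j • Q = 0 :=
        LocalTorsion.eq_zero_of_isInReductionKernel_of_prime_nsmul (W.baseChange ℚ_[ℓ]) hp.out hℓp
          h1.1 h2
      exact ih Q hQ h3
  -- `T → E/E₁` is an injective homomorphism
  let f : T →+ (W.baseChange ℚ_[ℓ]).toAffine.Point ⧸ E1 := (QuotientAddGroup.mk' E1).comp T.subtype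
  have hf : Function.Injective f := by
    rw [injective_iff_map_eq_zero]
    intro x hx
    have hmem : (x : (W.baseChange ℚ_[ℓ]).toAffine.Point) ∈ E1 :=
      (QuotientAddGroup.eq_zero_iff _).mp hx
    obtain ⟨k, hk⟩ := (AddCommGroup.mem_primaryComponent).mp x.2
    exact Subtype.ext (key k _ hmem hk)
  rw [AddSubgroup.index_eq_card]
  exact AddSubgroup.card_dvd_of_injective f hf

/-! ## §2. Transport `ℚ_v ≅ ℚ_[ℓ]` -/

omit [W.IsGloballyMinimal] in
/-- **`#E(ℚ_v)[p^∞] = #E(ℚ_[ℓ])[p^∞]` and both are finite** (`v` the place of `ℚ` above the prime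
`ℓ ≠ p`): points are transported both ways along Mathlib's `adicCompletion.padicEquiv v : ℚ_v ≃ₐ ℚ_[ℓ]`
(injective group homomorphisms preserving `p`-power torsion); `E(ℚ_v)[p^∞]` is finite by FILE 2
(`finite_primaryComponent_point_adicCompletion`). [folklore] -/
theorem finite_and_natCard_primaryComponent_adicCompletion_eq (v : HeightOneSpectrum (𝓞 ℚ))
    (ℓ p : ℕ) [Fact ℓ.Prime] [Fact p.Prime] (hv : (primesEquiv v : ℕ) = ℓ)
    (hpv : (p : 𝓞 ℚ) ∉ v.asIdeal) :
    Finite (AddCommGroup.primaryComponent (W.baseChange ℚ_[ℓ]).toAffine.Point p) ∧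
      Nat.card (AddCommGroup.primaryComponent (W.baseChange (v.adicCompletion ℚ)).toAffine.Point p) =
        Nat.card (AddCommGroup.primaryComponent (W.baseChange ℚ_[ℓ]).toAffine.Point p) := by
  subst hv
  haveI hfin := finite_primaryComponent_point_adicCompletion W (p := p) hpv
  -- the two transports
  let e : v.adicCompletion ℚ →ₐ[ℚ] ℚ_[(primesEquiv v : ℕ)] :=
    ((adicCompletion.padicEquiv v : v.adicCompletion ℚ ≃A[ℚ] ℚ_[(primesEquiv v : ℕ)]) :
      v.adicCompletion ℚ →ₐ[ℚ] ℚ_[(primesEquiv v : ℕ)])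
  let e' : ℚ_[(primesEquiv v : ℕ)] →ₐ[ℚ] v.adicCompletion ℚ :=
    (((adicCompletion.padicEquiv v : v.adicCompletion ℚ ≃A[ℚ] ℚ_[(primesEquiv v : ℕ)]).symm :
      ℚ_[(primesEquiv v : ℕ)] ≃A[ℚ] v.adicCompletion ℚ) :
      ℚ_[(primesEquiv v : ℕ)] →ₐ[ℚ] v.adicCompletion ℚ)
  have hinj := Affine.Point.map_injective (W' := W) (f := e)
  have hinj' := Affine.Point.map_injective (W' := W) (f := e')
  -- induced maps on the `p`-primary components
  let F : AddCommGroup.primaryComponent (W.baseChange (v.adicCompletion ℚ)).toAffine.Point p →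
      AddCommGroup.primaryComponent (W.baseChange ℚ_[(primesEquiv v : ℕ)]).toAffine.Point p :=
    fun R ↦ ⟨Affine.Point.map e (R : (W.baseChange (v.adicCompletion ℚ)).toAffine.Point), by
      obtain ⟨k, hk⟩ := (AddCommGroup.mem_primaryComponent).mp R.2
      exact (AddCommGroup.mem_primaryComponent).mpr ⟨k, by rw [← map_nsmul, hk, map_zero]⟩⟩
  let F' : AddCommGroup.primaryComponent (W.baseChange ℚ_[(primesEquiv v : ℕ)]).toAffine.Point p →
      AddCommGroup.primaryComponent (W.baseChange (v.adicCompletion ℚ)).toAffine.Point p :=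
    fun R ↦ ⟨Affine.Point.map e' (R : (W.baseChange ℚ_[(primesEquiv v : ℕ)]).toAffine.Point), by
      obtain ⟨k, hk⟩ := (AddCommGroup.mem_primaryComponent).mp R.2
      exact (AddCommGroup.mem_primaryComponent).mpr ⟨k, by rw [← map_nsmul, hk, map_zero]⟩⟩
  have hF : Function.Injective F := fun a b hab ↦
    Subtype.ext (hinj (congrArg Subtype.val hab))
  have hF' : Function.Injective F' := fun a b hab ↦
    Subtype.ext (hinj' (congrArg Subtype.val hab))
  haveI : Finite (AddCommGroup.primaryComponent
      (W.baseChange ℚ_[(primesEquiv v : ℕ)]).toAffine.Point p) := Finite.of_injective F' hF'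
  exact ⟨inferInstance, le_antisymm (Nat.card_le_card_of_injective F hF)
    (Nat.card_le_card_of_injective F' hF')⟩

/-- **`#E(ℚ_v)[p^∞] ∣ c_v · N_ℓ`** at the place `v` of `ℚ` above the prime `ℓ ≠ p` (`W` globally
minimal). [cite: SilvermanAEC2009, VII.2 Prop. 2.1, VII.3 Prop. 3.1 and VII.6.1] -/
theorem natCard_primaryComponent_adicCompletion_dvd (v : HeightOneSpectrum (𝓞 ℚ)) (ℓ p : ℕ)
    [Fact ℓ.Prime] [Fact p.Prime] (hv : (primesEquiv v : ℕ) = ℓ) (hℓp : ℓ ≠ p)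
    (hpv : (p : 𝓞 ℚ) ∉ v.asIdeal) :
    Nat.card (AddCommGroup.primaryComponent (W.baseChange (v.adicCompletion ℚ)).toAffine.Point p) ∣
      (W.baseChange (v.adicCompletion ℚ)).localTamagawaNumber (v.adicCompletionIntegers ℚ) *
        reductionPointCount W ℓ := by
  have hrp : ratPlace ℓ = v := by
    subst hv
    rw [ratPlace]
    have : (⟨(primesEquiv v : ℕ), Fact.out⟩ : Nat.Primes) = primesEquiv v := Subtype.ext rfl
    rw [this, Equiv.symm_apply_apply]
  rw [(finite_and_natCard_primaryComponent_adicCompletion_eq W v ℓ p hv hpv).2]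
  have h := natCard_primaryComponent_padic_dvd W ℓ p hℓp
  rwa [hrp] at h

/-! ## §3. The local tower kernel: `#𝒦_{v,0}[p^∞] ≤ p ^ ord_p (c_ℓ · N_ℓ)` -/

/-- `c_v · N_ℓ ≠ 0`: the local Tamagawa number of an elliptic curve over `ℚ_ℓ` is a positive integer
(tree `localTamagawaNumber_padic_ne_zero_holds`, `localTamagawaNumber_padic_eq_holds`; Silverman
Cor. VII.6.2) and `#Ẽ_ns(𝔽_ℓ) > 0` (`reductionPointCount_pos`). [cite: SilvermanAEC2009, Cor. VII.6.2] -/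
theorem localTamagawaNumber_mul_reductionPointCount_ne_zero (v : HeightOneSpectrum (𝓞 ℚ)) (ℓ : ℕ)
    [Fact ℓ.Prime] (hv : (primesEquiv v : ℕ) = ℓ) :
    (W.baseChange (v.adicCompletion ℚ)).localTamagawaNumber (v.adicCompletionIntegers ℚ) *
        reductionPointCount W ℓ ≠ 0 := by
  refine mul_ne_zero ?_ (W.reductionPointCount_pos ℓ).ne'
  rw [← localTamagawaNumber_padic_eq_holds W v ℓ hv]
  exact localTamagawaNumber_padic_ne_zero_holds ℓ (W.baseChange ℚ_[ℓ])

/-- **`#𝒦_{v,0}[p^∞] ≤ p ^ ord_p (c_ℓ · N_ℓ)` at every prime `ℓ ≠ p`, for EVERY `ℤ_p`-extension of `ℚ`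
and every reduction type** (`W` globally minimal; `v` the place above `ℓ`): FILE 2's count
`#𝒦_{v,0}[p^∞] ≤ #E(ℚ_v)[p^∞]`, the `p`-group `E(ℚ_v)[p^∞]` having order dividing `c_ℓ · N_ℓ`
(X11b `TamagawaCoinvariants.natCard_le_pow_padicValNat_of_dvd`). Greenberg, LNM 1716, Lemma 3.3 and
the Remark after Prop. 3.8 (p. 95: "(ii) and (iii) … `p ∤ c_l`"), here in counted form.
[cite: GreenbergLNM1716, §3 Lemma 3.3 (pp. 86–88) and Prop. 3.8 Remark (p. 95)]
[cite: SilvermanAEC2009, VII.2 Prop. 2.1, VII.3 Prop. 3.1 and VII.6.1] -/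
theorem natCard_localTowerKerPrimary_zero_le_pow_padicValNat_rat {p : ℕ} [Fact p.Prime]
    (κ : ZpExtension ℚ p) (v : HeightOneSpectrum (𝓞 ℚ)) (ℓ : ℕ) [Fact ℓ.Prime]
    (hv : (primesEquiv v : ℕ) = ℓ) (hℓp : ℓ ≠ p) (hpv : (p : 𝓞 ℚ) ∉ v.asIdeal) :
    Nat.card (W.localTowerKerPrimary κ (v.adicCompletion ℚ) 0) ≤
      p ^ padicValNat p ((W.baseChange (v.adicCompletion ℚ)).localTamagawaNumber
          (v.adicCompletionIntegers ℚ) * reductionPointCount W ℓ) := by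
  haveI := finite_primaryComponent_point_adicCompletion W (p := p) hpv
  have hprim : ∀ x : AddCommGroup.primaryComponent
      (W.baseChange (v.adicCompletion ℚ)).toAffine.Point p, ∃ k : ℕ, p ^ k • x = 0 := fun x ↦ by
    obtain ⟨k, hk⟩ := (AddCommGroup.mem_primaryComponent).mp x.2
    exact ⟨k, Subtype.ext (by rw [AddSubgroupClass.coe_nsmul, hk]; rfl)⟩
  exact (natCard_localTowerKerPrimary_zero_le_natCard_primaryComponent W κ hpv).trans
    (TamagawaCoinvariants.natCard_le_pow_padicValNat_of_dvd p hprim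
      (localTamagawaNumber_mul_reductionPointCount_ne_zero W v ℓ hv)
      (natCard_primaryComponent_adicCompletion_dvd W v ℓ p hv hℓp hpv))

/-- **Non-anomalous at the bad prime: `p ∤ N_ℓ ⟹ #𝒦_{v,0}[p^∞] ≤ p ^ ord_p c_ℓ`** (`ℓ ≠ p`, every
`ℤ_p`-extension of `ℚ`, every reduction type; `W` globally minimal). The Tamagawa factor `c_ℓ` may be
divisible by `p`: its `p`-part is exactly what the Tamagawa-tolerant consumer (FILE 4) absorbs in
`ord_p #Ш_an = ord_p q − ord_p ∏ c_ℓ`. [cite: GreenbergLNM1716, §3 Lemma 3.3 (pp. 86–88) and Prop. 3.8 Remark (p. 95)] -/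
theorem natCard_localTowerKerPrimary_zero_le_pow_padicValNat_of_not_dvd {p : ℕ} [hp : Fact p.Prime]
    (κ : ZpExtension ℚ p) (v : HeightOneSpectrum (𝓞 ℚ)) (ℓ : ℕ) [Fact ℓ.Prime]
    (hv : (primesEquiv v : ℕ) = ℓ) (hℓp : ℓ ≠ p) (hpv : (p : 𝓞 ℚ) ∉ v.asIdeal)
    (hN : ¬ p ∣ reductionPointCount W ℓ) :
    Nat.card (W.localTowerKerPrimary κ (v.adicCompletion ℚ) 0) ≤
      p ^ padicValNat p ((W.baseChange (v.adicCompletion ℚ)).localTamagawaNumber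
          (v.adicCompletionIntegers ℚ)) := by
  have h := natCard_localTowerKerPrimary_zero_le_pow_padicValNat_rat W κ v ℓ hv hℓp hpv
  have hne := localTamagawaNumber_mul_reductionPointCount_ne_zero W v ℓ hv
  rw [padicValNat.mul (left_ne_zero_of_mul hne) (right_ne_zero_of_mul hne),
    padicValNat.eq_zero_of_not_dvd hN, add_zero] at h
  exact h

/-- **Finiteness + count packaged for the consumer**: at the place `v` above a prime `ℓ ≠ p` with
`p ∤ N_ℓ`, `𝒦_{v,0}[p^∞]` is finite of order `≤ p ^ ord_p c_v`, for every `ℤ_p`-extension.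
[cite: GreenbergLNM1716, §3 Lemma 3.3 (pp. 86–88) and Prop. 3.8 Remark (p. 95)] -/
theorem finite_and_natCard_localTowerKerPrimary_zero_le_of_not_dvd {p : ℕ} [Fact p.Prime]
    (κ : ZpExtension ℚ p) (v : HeightOneSpectrum (𝓞 ℚ)) (ℓ : ℕ) [Fact ℓ.Prime]
    (hv : (primesEquiv v : ℕ) = ℓ) (hℓp : ℓ ≠ p) (hpv : (p : 𝓞 ℚ) ∉ v.asIdeal)
    (hN : ¬ p ∣ reductionPointCount W ℓ) :
    Finite (W.localTowerKerPrimary κ (v.adicCompletion ℚ) 0) ∧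
      Nat.card (W.localTowerKerPrimary κ (v.adicCompletion ℚ) 0) ≤
        p ^ padicValNat p ((W.baseChange (v.adicCompletion ℚ)).localTamagawaNumber
          (v.adicCompletionIntegers ℚ)) :=
  ⟨W.finite_localTowerKerPrimary_zero_of_not_mem κ hpv,
    natCard_localTowerKerPrimary_zero_le_pow_padicValNat_of_not_dvd W κ v ℓ hv hℓp hpv hN⟩

end Summit.BirchSwinnertonDyer.Rank1Residual.Iwasawa

end
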